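import Summits.ABC.IUTFork.Joshi.ThetaLociProductsBundling
import Summits.ABC.IUTFork.Joshi.BundlingRingsModel
import HarnessLib

/-!
# Non-vacuity model for the §7.8 signatures of `Joshi/ThetaLociProducts.lean` (companion; satisfiability check)

Block E of the abc-iut cell (rung LADDER-ABC:A2.E; seat abc-iut-E-t15, slot T-15). `Joshi/ThetaLociProducts.lean`
(p429035) types K. Joshi, *Construction of Arithmetic Teichmüller Spaces III*, arXiv:2401.13508v4 (UNREFEREED, disputed;
bib `Joshi2024ATS3`) §7.8 over ABSTRACT carriers — the signatures `BundlingDatum`, `NormedBundlingDatum`,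
`AdelicBundlingDatum` — with the printed assertions as claim-`Prop`s (`TensorPowerDecomposition` = Lemma 7.8.1.2,
`SupInequality` = Rmk. 7.8.3.2, `Decomposition` / `HatHatLowerBound` = Thm. 7.8.3.1) and CONDITIONAL theorems
(`supInequality_of_norm_mul_le`, `supHat_eq_supHatHat_of_cross_norm`, `hatHatLowerBound_of_witness`).
`Joshi/ThetaLociProductsBundling.lean` (p430205) BUILDS the §7.8 carrier from abc-iut-E-t13's §7.5/§7.7 signature
`PrimeBundlingDatum` (`toBundlingDatum`), and `Joshi/BundlingRingsModel.lean` (E-t13, p429810) gives a toy INHABITANT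
`PrimeBundlingDatum.toyModel` of that signature (all carriers `ℚ`, one place, `ℓ⋆ = 1`).

THIS FILE composes the two: (1) the three §7.8 signatures are INHABITED in kernel (`BundlingDatum.toyModel`,
`NormedBundlingDatum.toyModel`, `AdelicBundlingDatum.toyModel` — one rational prime, all norms constant `1`, theta bound `1/2`);
(2) the hypotheses of every conditional theorem of p429035 are JOINTLY SATISFIABLE there, so none of them is a vacuous
implication (CONVENTIONS §4 «vacuity smells»; plan/E/README.md §5): `SupInequality`, the equality of the two suprema, and the
READING `HatHatLowerBound` all HOLD in the toy; (3) Lemma 7.8.1.2 AS TYPED (`TensorPowerDecomposition`) HOLDS for every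
§7.8 carrier with ONE label (`J = Fin 1`: the multiplication arrow (7.8.1.1) `B̆^{⊗1} → B̆` is an isomorphism,
`tensorPowOneEquiv`) — a degenerate case (print has `ℓ⋆ ≥ 2`), recorded only as satisfiability of the typed `Prop`.
It says NOTHING about Joshi's actual objects (Fargues–Fontaine rings, theta-values loci) and takes no side on [IUTchIII]
Cor. 3.12, on Joshi's claims or on Mochizuki's report on them; typed ≠ proved ≠ endorsed. Standard axioms; sorry-free;
no instance / notation. bears_on: LADDER-ABC:A2.E.
-/

noncomputable section

open scoped TensorProduct

namespace Summit.ABC.IUTFork.Joshi.ATS3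

/-! ## Lemma 7.8.1.2 as typed holds for one label (`J = Fin 1`) -/

section OneLabel

variable (B : Type*) (A : Type*) [CommRing B] [CommRing A] [Algebra B A]

/-- For a single label the tensor power `A^{⊗_B 1}` IS `A`: Mathlib's `PiTensorProduct.subsingletonEquiv`, upgraded to a
`B`-algebra isomorphism (`a ↦ ⊗_{j ∈ Fin 1} a` is multiplicative, `PiTensorProduct.tprod_mul_tprod`). [folklore] -/
def tensorPowOneEquiv : A ≃ₐ[B] TensorPow B A (Fin 1) :=
  AlgEquiv.ofLinearEquiv (PiTensorProduct.subsingletonEquiv (R := B) (s := fun _ : Fin 1 => A) 0).symm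
    (by rw [PiTensorProduct.subsingletonEquiv_symm_apply']; rfl)
    (fun x y => by
      rw [PiTensorProduct.subsingletonEquiv_symm_apply', PiTensorProduct.subsingletonEquiv_symm_apply',
        PiTensorProduct.subsingletonEquiv_symm_apply', PiTensorProduct.tprod_mul_tprod]
      rfl)

/-- `tensorPowOneEquiv a = ⊗_{j ∈ Fin 1} a` (the pure tensor `toTensor` of the constant tuple). [folklore] -/
theorem tensorPowOneEquiv_apply (a : A) : tensorPowOneEquiv B A a = toTensor B (fun _ : Fin 1 => a) :=
  PiTensorProduct.subsingletonEquiv_symm_apply' (R := B) (0 : Fin 1) a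

end OneLabel

namespace BundlingDatum

variable {K : Type*} {B : Type*} {A : Type*} [Field K] [CommRing B] [Algebra K B] [CommRing A] [Algebra B A]
  {W : Type} (D : BundlingDatum K B A W (Fin 1))

/-- **Lemma 7.8.1.2 AS TYPED holds when there is one label**: with `J = Fin 1` the presented ring's first tensor power is
the presented ring itself, `B ⊗_K (⊕_w E′_w)`, so the typed `TensorPowerDecomposition` is witnessed by `α := W`,
`E″ := E′` and `tensorPowOneEquiv`. Degenerate case (print: `ℓ⋆ ≥ 2`); recorded as SATISFIABILITY of the typed claim, not as
progress on Lemma 7.8.1.2. [folklore] -/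
theorem tensorPowerDecomposition_of_one_label : D.TensorPowerDecomposition :=
  ⟨W, D.Eprime, D.finite_W, D.finiteDimensional_Eprime, ⟨(tensorPowOneEquiv B D.Presented).symm⟩⟩

end BundlingDatum

/-! ## The toy inhabitants -/

namespace BundlingDatum

/-- **The §7.8 signature is INHABITED**: the §7.8 carrier of E-t13's toy `PrimeBundlingDatum` (`K = B_p = ℚ`, one place `w` with
`E′_w = B_{E′_w} = ℚ`, `ℓ⋆ = 1`), via E-t15's `toBundlingDatum` (p430205): `A = B̑_p = ⊕_{w} ℚ ⊗_ℚ ℚ`, `E′_w ⊂ Q̄` the image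
of `ℚ`, theta-values locus = the (7.5.2.2)-image of the single bundled tuple `(1/2)`. [folklore] -/
def toyModel : BundlingDatum ℚ ℚ PrimeBundlingDatum.toyModel.BundleTensE PrimeBundlingDatum.toyModel.Vss (Fin 1) :=
  PrimeBundlingDatum.toyModel.toBundlingDatum

/-- The bundled tuple `(1/2)` of E-t13's toy locus, transported to `B̑_p^{ℓ⋆}` — an explicit member of the toy
theta-values locus. [folklore] -/
def toyTuple : Fin 1 → PrimeBundlingDatum.toyModel.BundleTensE :=
  fun _ => PrimeBundlingDatum.toyModel.bundleOddToTensE fun _ => (1 / 2 : ℚ)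

/-- `toyTuple ∈ Θ̃_{Joshi,p}` of the toy carrier. [folklore] -/
theorem toyTuple_mem : toyTuple ∈ toyModel.thetaLocus :=
  ⟨fun _ _ => (1 / 2 : ℚ), fun _ => rfl, rfl⟩

/-- The toy theta-values locus is nonempty. [folklore] -/
theorem toyModel_thetaLocus_nonempty : toyModel.thetaLocus.Nonempty := ⟨toyTuple, toyTuple_mem⟩

/-- Lemma 7.8.1.2 as typed HOLDS for the toy carrier (one label). [folklore] -/
theorem toyModel_tensorPowerDecomposition : toyModel.TensorPowerDecomposition :=
  toyModel.tensorPowerDecomposition_of_one_label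

end BundlingDatum

namespace NormedBundlingDatum

/-- **The normed §7.8 signature is INHABITED**: the toy carrier with both norm functions constant `1` (`|·|_{B̆} := 1` on `B̑_p`,
tensor norm `:= 1`). [folklore] -/
def toyModel : NormedBundlingDatum ℚ ℚ PrimeBundlingDatum.toyModel.BundleTensE PrimeBundlingDatum.toyModel.Vss (Fin 1) :=
  { BundlingDatum.toyModel with normA := fun _ => 1, normT := fun _ => 1 }

/-- The underlying §7.8 carrier of the normed toy is the toy carrier. [folklore] -/
theorem toyModel_toBundlingDatum : toyModel.toBundlingDatum = BundlingDatum.toyModel := rfl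

/-- A constant-`1` image set is bounded above. [folklore] -/
private theorem bddAbove_image_const_one {X : Type*} (S : Set X) : BddAbove ((fun _ : X => (1 : ℝ)) '' S) :=
  ⟨1, by rintro _ ⟨_, _, rfl⟩; exact le_rfl⟩

/-- **The hypotheses of `supInequality_of_norm_mul_le` are jointly satisfiable**, hence Rmk. 7.8.3.2's inequality
`SupInequality` HOLDS in the toy (non-vacuity of the conditional theorem of p429035). [folklore] -/
theorem toyModel_supInequality : toyModel.SupInequality :=
  toyModel.supInequality_of_norm_mul_le BundlingDatum.toyModel_thetaLocus_nonempty
    (bddAbove_image_const_one _) fun _ _ => le_rfl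

/-- **The hypotheses of `supHat_eq_supHatHat_of_cross_norm` are jointly satisfiable** (constant-`1` norms are «cross» and
«multiplicative» on one-label tuples), hence the two suprema of Rmk. 7.8.3.2 COINCIDE in the toy. [folklore] -/
theorem toyModel_supHat_eq_supHatHat : toyModel.supHat = toyModel.supHatHat :=
  toyModel.supHat_eq_supHatHat_of_cross_norm (fun _ _ => by simp [toyModel]) (fun _ _ => by simp [toyModel])

end NormedBundlingDatum

namespace AdelicBundlingDatum

/-- **The adelic §7.8.3 signature is INHABITED**: one active rational prime (`P = Unit`), the normed toy carrier at it, adelic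
norm constant `1`, theta bound `Π_w |q_w^{1/2ℓ}|^{ℓ⋆} := 1/2` (E-t13's toy `qRoot`). [folklore] -/
def toyModel : AdelicBundlingDatum Unit (fun _ => ℚ) (fun _ => ℚ) (fun _ => PrimeBundlingDatum.toyModel.BundleTensE)
    (fun _ => PrimeBundlingDatum.toyModel.Vss) (Fin 1) where
  finite_P := inferInstance
  loc := fun _ => NormedBundlingDatum.toyModel
  adelicNorm := fun _ => 1
  thetaBound := 1 / 2

/-- An explicit member of the toy `Θ̂̂^{B̆}_Joshi ⊂ Π_p B̆_p`: at the unique prime, the product of the toy tuple. [folklore] -/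
theorem toyWitness_mem : (fun _ : Unit => mulMap BundlingDatum.toyTuple) ∈ toyModel.hatHatLocus :=
  fun _ _ => Set.mem_image_of_mem _ BundlingDatum.toyTuple_mem

/-- Thm. 7.8.3.1's decomposition clause (= Lemma 7.8.1.2 at every active prime) HOLDS in the toy (one label). [folklore] -/
theorem toyModel_decomposition : toyModel.Decomposition :=
  fun _ => BundlingDatum.toyModel_tensorPowerDecomposition

/-- **The hypotheses of `hatHatLowerBound_of_witness` are jointly satisfiable**, hence the READING `HatHatLowerBound` of
Thm. 7.8.3.1's last sentence HOLDS in the toy (`1/2 ≤ 1 = sup`). [folklore] -/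
theorem toyModel_hatHatLowerBound : toyModel.HatHatLowerBound :=
  toyModel.hatHatLowerBound_of_witness toyWitness_mem (by norm_num [toyModel])
    ⟨1, by rintro _ ⟨_, _, rfl⟩; exact le_rfl⟩

/-- Packaged: the §7.8.3 signature admits an inhabitant in which the decomposition clause, the sup-inequality at every prime and
the lower-bound reading hold simultaneously (so the typed §7.8 claims are jointly satisfiable, i.e. not refutable from the
signature alone). [folklore] -/
theorem claims_satisfiable :
    ∃ D : AdelicBundlingDatum Unit (fun _ => ℚ) (fun _ => ℚ) (fun _ => PrimeBundlingDatum.toyModel.BundleTensE)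
        (fun _ => PrimeBundlingDatum.toyModel.Vss) (Fin 1),
      D.Decomposition ∧ (∀ p, (D.loc p).SupInequality) ∧ D.HatHatLowerBound :=
  ⟨toyModel, toyModel_decomposition, fun _ => NormedBundlingDatum.toyModel_supInequality, toyModel_hatHatLowerBound⟩

end AdelicBundlingDatum

end Summit.ABC.IUTFork.Joshi.ATS3

end
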